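import Mathlib.Data.Matrix.Mul
import Mathlib.Data.Matrix.Basic
import Mathlib.LinearAlgebra.Matrix.Trace
import Mathlib.Algebra.BigOperators.Fin
import Mathlib.Algebra.BigOperators.Ring.Finset
import Mathlib.Algebra.BigOperators.GroupWithZero.Finset
import Mathlib.Data.Fin.Tuple.Basic
import Mathlib.Data.Fintype.Pi
import Mathlib.Data.Fintype.BigOperators
import HarnessLib

/-!
# Traces of powers as closed-walk sums; the label expansion of `tr((BᵀB)^q)`
(the combinatorial side of the trace method, Allen–O'Donnell–Witmer 2015, App. A.4)

Trunk T-CPLX-CORE (Literature/Computability/Complexity). Support file for the discharge of the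
named fact `allen_odonnell_witmer_kSAT` (`AOWRefutation.lean`), probabilistic part II
(deterministic algebra).

* `chainProd`, `pow_apply_eq_sum_chainProd` — `(M^{n+1})_{ab} = ∑_{r₁…rₙ} M_{a r₁} ⋯ M_{rₙ b}`;
* `trace_pow_eq_sum_cyclic` — `tr(M^{n+1}) = ∑_{c : ℤ/(n+1) → κ} ∏_j M_{c_j c_{j+1}}` (closed walks);
* `trace_pow_transpose_mul_self` — `tr((BᵀB)^{n+1}) = ∑_{v} ∑_{u} ∏_j B_{u_j v_j} B_{u_j v_{j+1}}`;
* `fiberMatrix row col g` — the matrix whose `(u,v)` entry is the sum of `g` over the labels `ℓ`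
  with `row ℓ = u`, `col ℓ = v` (the shape of every AOW level matrix: entries are signed sums of
  constraint indicators), and **the label expansion** `trace_pow_fiberMatrix`:
  `tr((BᵀB)^{n+1}) = ∑_{L, L' : ℤ/(n+1) → Λ} [Adm L L'] ∏_j g(L_j) g(L'_j)`, where the admissible
  pairs of label sequences are those of a closed walk: `row L'_j = row L_j`, `col L'_j = col L_{j+1}`
  (`IsAdmissible`). This is the expansion `tr((AAᵀ)^r) = ∑ P_{J,L}` of AOW, App. A.4, for
  matrices with independent-sum entries.

## References

* S. R. Allen, R. O'Donnell, D. Witmer, *How to refute a random CSP*, FOCS 2015,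
  arXiv:1505.04383, App. A.4 (expansion of `tr((AAᵀ)^r)`).
* Z. Füredi, J. Komlós, *The eigenvalues of random symmetric matrices*, Combinatorica 1 (1981),
  §3 (trace of a power as a sum over closed walks).
-/

namespace Literature.Computability.Complexity

open Finset Matrix

variable {κ R : Type} [Fintype κ] [CommRing R]

/-! ### Entries of powers as chain sums -/

/-- The product of matrix entries along the chain `a, r₁, …, rₙ, b`. [Füredi–Komlós 1981, §3] [folklore] -/
def chainProd (M : Matrix κ κ R) {n : ℕ} (a : κ) (rs : Fin n → κ) (b : κ) : R :=
  ∏ j : Fin (n + 1), M ((Fin.cons a (Fin.snoc rs b) : Fin (n + 2) → κ) j.castSucc)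
    ((Fin.cons a (Fin.snoc rs b) : Fin (n + 2) → κ) j.succ)

/-- **Entries of powers are chain sums**: `(M^{n+1})_{ab} = ∑_{r₁…rₙ} M_{a r₁} M_{r₁ r₂} ⋯ M_{rₙ b}`.
[Füredi–Komlós 1981, §3] [folklore] -/
theorem pow_apply_eq_sum_chainProd [DecidableEq κ] (M : Matrix κ κ R) (n : ℕ) (a b : κ) :
    (M ^ (n + 1)) a b = ∑ rs : Fin n → κ, chainProd M a rs b := by
  induction n generalizing a b with
  | zero =>
    rw [pow_one, Fintype.sum_unique]
    unfold chainProd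
    rw [Fin.prod_univ_one]
    simp only [Fin.castSucc_zero, Fin.cons_zero, Fin.succ_zero_eq_one, Fin.cons_one]
    rfl
  | succ n ih =>
    rw [pow_succ', Matrix.mul_apply]
    simp_rw [ih]
    rw [← Equiv.sum_comp (Fin.consEquiv fun _ => κ), Fintype.sum_prod_type]
    simp only [Finset.mul_sum]
    refine Finset.sum_congr rfl fun r _ => Finset.sum_congr rfl fun rs _ => ?_
    simp only [Fin.consEquiv, Equiv.coe_fn_mk]
    have hc : (Fin.snoc (Fin.cons r rs) b : Fin (n + 2) → κ) = Fin.cons r (Fin.snoc rs b) :=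
      (Fin.cons_snoc_eq_snoc_cons r rs b).symm
    simp only [chainProd, hc]
    rw [Fin.prod_univ_succ (n := n + 1)]
    simp only [Fin.castSucc_zero, Fin.cons_zero, Fin.cons_succ, ← Fin.succ_castSucc]

/-- Closing a sequence into a cycle: the successor point. [folklore] -/
theorem snoc_self_apply_succ {α : Type} {n : ℕ} (rs : Fin (n + 1) → α) (j : Fin (n + 1)) :
    (Fin.snoc rs (rs 0) : Fin (n + 2) → α) j.succ = rs (j + 1) := by
  induction j using Fin.lastCases with
  | last => rw [Fin.succ_last, Fin.snoc_last, Fin.last_add_one]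
  | cast j => rw [Fin.coeSucc_eq_succ, Fin.succ_castSucc, Fin.snoc_castSucc]

omit [Fintype κ] in
/-- A cyclic product as a chain product closed at the first point. [folklore] -/
theorem prod_cyclic_eq_chain (M : Matrix κ κ R) {n : ℕ} (rs : Fin (n + 1) → κ) :
    ∏ j, M (rs j) (rs (j + 1)) =
      ∏ j : Fin (n + 1), M ((Fin.snoc rs (rs 0) : Fin (n + 2) → κ) j.castSucc)
        ((Fin.snoc rs (rs 0) : Fin (n + 2) → κ) j.succ) := by
  refine Finset.prod_congr rfl fun j _ => ?_
  rw [Fin.snoc_castSucc, snoc_self_apply_succ]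

/-- **The trace of a power is a sum over closed walks**:
`tr(M^{n+1}) = ∑_{c : ℤ/(n+1) → κ} ∏_j M_{c_j, c_{j+1}}` (indices mod `n+1`).
[Füredi–Komlós 1981, §3; Allen–O'Donnell–Witmer 2015, App. A.4] [folklore] -/
theorem trace_pow_eq_sum_cyclic [DecidableEq κ] (M : Matrix κ κ R) (n : ℕ) :
    (M ^ (n + 1)).trace = ∑ rs : Fin (n + 1) → κ, ∏ j, M (rs j) (rs (j + 1)) := by
  rw [Matrix.trace]
  simp only [Matrix.diag, pow_apply_eq_sum_chainProd, prod_cyclic_eq_chain]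
  symm
  rw [← Equiv.sum_comp (Fin.consEquiv fun _ => κ), Fintype.sum_prod_type]
  refine Finset.sum_congr rfl fun a _ => Finset.sum_congr rfl fun rs _ => ?_
  simp only [Fin.consEquiv, Equiv.coe_fn_mk, Fin.cons_zero]
  rw [chainProd, Fin.cons_snoc_eq_snoc_cons]

/-! ### `tr((BᵀB)^q)` as a double walk sum -/

variable {U V : Type} [Fintype U] [Fintype V]

/-- `tr((BᵀB)^{n+1}) = ∑_{v : ℤ/(n+1) → V} ∑_{u : ℤ/(n+1) → U} ∏_j B_{u_j v_j} B_{u_j v_{j+1}}`: the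
closed walks of `BᵀB` alternate between column and row indices of `B`. [Allen–O'Donnell–Witmer
2015, App. A.4 (first display in the proof of Lemma A.2)] [cite: arXiv150504383, App. A] -/
theorem trace_pow_transpose_mul_self [DecidableEq V] (B : Matrix U V R) (n : ℕ) :
    ((Bᵀ * B) ^ (n + 1)).trace =
      ∑ v : Fin (n + 1) → V, ∑ u : Fin (n + 1) → U, ∏ j, B (u j) (v j) * B (u j) (v (j + 1)) := by
  rw [trace_pow_eq_sum_cyclic]
  refine Finset.sum_congr rfl fun v _ => ?_
  simp only [Matrix.mul_apply, Matrix.transpose_apply]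
  exact Fintype.prod_sum fun j u => B u (v j) * B u (v (j + 1))

/-- Reordering a fourfold sum. [folklore] -/
theorem sum_four_comm {α β γ δ : Type} [Fintype α] [Fintype β] [Fintype γ] [Fintype δ]
    (f : α → β → γ → δ → R) :
    ∑ a, ∑ b, ∑ c, ∑ d, f a b c d = ∑ c, ∑ d, ∑ a, ∑ b, f a b c d := by
  calc ∑ a, ∑ b, ∑ c, ∑ d, f a b c d = ∑ a, ∑ c, ∑ b, ∑ d, f a b c d :=
        Finset.sum_congr rfl fun a _ => Finset.sum_comm
    _ = ∑ c, ∑ a, ∑ b, ∑ d, f a b c d := Finset.sum_comm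
    _ = ∑ c, ∑ a, ∑ d, ∑ b, f a b c d :=
        Finset.sum_congr rfl fun c _ => Finset.sum_congr rfl fun a _ => Finset.sum_comm
    _ = ∑ c, ∑ d, ∑ a, ∑ b, f a b c d := Finset.sum_congr rfl fun c _ => Finset.sum_comm

/-! ### Fiber matrices and the label expansion -/

variable {Λ : Type} [Fintype Λ] [DecidableEq U] [DecidableEq V]

/-- The **fiber matrix** of a label weighting `g`: entry `(u,v)` is the sum of `g ℓ` over the labels
`ℓ` lying over `(u,v)` (`row ℓ = u`, `col ℓ = v`). Every AOW level matrix has this shape, with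
labels = constraints and `g` = sign × (indicator − `p`). [Allen–O'Donnell–Witmer 2015, App. A
(`B_{U₁,U₂} = w(U₁,U₂)`, `w` a sum over constraints)] [cite: arXiv150504383, App. A] -/
def fiberMatrix (row : Λ → U) (col : Λ → V) (g : Λ → R) : Matrix U V R :=
  Matrix.of fun u v => ∑ l, if row l = u ∧ col l = v then g l else 0

/-- **Admissible pairs of label sequences** (the closed walks of `BᵀB` lifted to labels): the
`j`-th labels share their row, and the second `j`-th label shares its column with the first
`(j+1)`-st (indices mod `n+1`). [Allen–O'Donnell–Witmer 2015, App. A.4 (the index pattern of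
`P_{J,L}`)] [cite: arXiv150504383, App. A] -/
def IsAdmissible (row : Λ → U) (col : Λ → V) {n : ℕ} (L L' : Fin (n + 1) → Λ) : Prop :=
  ∀ j, row (L' j) = row (L j) ∧ col (L' j) = col (L (j + 1))

/-- `IsAdmissible` is decidable. [folklore] -/
instance instDecidableIsAdmissible (row : Λ → U) (col : Λ → V) {n : ℕ} (L L' : Fin (n + 1) → Λ) :
    Decidable (IsAdmissible row col L L') := by
  unfold IsAdmissible
  infer_instance

/-- A product of guarded terms is the guard of the product. [folklore] -/
theorem prod_ite_zero_eq {m : ℕ} (c : Fin m → Prop) [DecidablePred c] (f : Fin m → R) :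
    ∏ j, (if c j then f j else 0) = if ∀ j, c j then ∏ j, f j else 0 := by
  split_ifs with h
  · exact Finset.prod_congr rfl fun j _ => if_pos (h j)
  · push Not at h
    obtain ⟨j, hj⟩ := h
    exact Finset.prod_eq_zero (Finset.mem_univ j) (if_neg hj)

/-- **The label expansion of `tr((BᵀB)^q)`** for a fiber matrix:
`tr((BᵀB)^{n+1}) = ∑_{L,L'} [IsAdmissible L L'] ∏_j g(L_j) g(L'_j)`.
[Allen–O'Donnell–Witmer 2015, App. A.4 (`tr((AAᵀ)^r) = ∑_{J,L} P_{J,L}`); Füredi–Komlós 1981, §3] [cite: arXiv150504383, App. A] -/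
theorem trace_pow_fiberMatrix [DecidableEq Λ] (row : Λ → U) (col : Λ → V) (g : Λ → R) (n : ℕ) :
    (((fiberMatrix row col g)ᵀ * fiberMatrix row col g) ^ (n + 1)).trace =
      ∑ L : Fin (n + 1) → Λ, ∑ L' : Fin (n + 1) → Λ,
        if IsAdmissible row col L L' then ∏ j, g (L j) * g (L' j) else 0 := by
  rw [trace_pow_transpose_mul_self]
  -- expand every entry over its labels
  have hexp : ∀ (v : Fin (n + 1) → V) (u : Fin (n + 1) → U),
      ∏ j, fiberMatrix row col g (u j) (v j) * fiberMatrix row col g (u j) (v (j + 1)) =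
        ∑ L : Fin (n + 1) → Λ, ∑ L' : Fin (n + 1) → Λ,
          (if ∀ j, row (L j) = u j ∧ col (L j) = v j then ∏ j, g (L j) else 0) *
            (if ∀ j, row (L' j) = u j ∧ col (L' j) = v (j + 1) then ∏ j, g (L' j) else 0) := by
    intro v u
    simp only [fiberMatrix, Matrix.of_apply]
    rw [Finset.prod_mul_distrib, Fintype.prod_sum, Fintype.prod_sum, Finset.sum_mul_sum]
    refine Finset.sum_congr rfl fun L _ => Finset.sum_congr rfl fun L' _ => ?_
    rw [prod_ite_zero_eq, prod_ite_zero_eq]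
  simp_rw [hexp]
  -- move the label sums outside
  rw [sum_four_comm]
  refine Finset.sum_congr rfl fun L _ => Finset.sum_congr rfl fun L' _ => ?_
  -- only `u = row ∘ L`, `v = col ∘ L` contribute
  rw [Finset.sum_eq_single (col ∘ L) ?_ (fun h => absurd (Finset.mem_univ _) h)]
  · rw [Finset.sum_eq_single (row ∘ L) ?_ (fun h => absurd (Finset.mem_univ _) h)]
    · have hA : ∀ j, row (L j) = (row ∘ L) j ∧ col (L j) = (col ∘ L) j := fun j => ⟨rfl, rfl⟩
      rw [if_pos hA]
      by_cases hadm : IsAdmissible row col L L'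
      · rw [if_pos hadm, if_pos (show ∀ j, row (L' j) = (row ∘ L) j ∧ col (L' j) = (col ∘ L) (j + 1)
          from fun j => hadm j), Finset.prod_mul_distrib]
      · rw [if_neg hadm, if_neg (show ¬ ∀ j, row (L' j) = (row ∘ L) j ∧ col (L' j) = (col ∘ L) (j + 1)
          from fun h => hadm fun j => h j), mul_zero]
    · intro u _ hu
      rw [if_neg (fun h => hu (funext fun j => ((h j).1).symm)), zero_mul]
  · intro v _ hv
    refine Finset.sum_eq_zero fun u _ => ?_
    rw [if_neg (fun h => hv (funext fun j => ((h j).2).symm)), zero_mul]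

end Literature.Computability.Complexity
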